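import Mathlib
import Summits.KontsevichZagierPeriods.KontsevichZagierPeriods.Theorems.TorsionLogsGKZLevelThreePairBetaArctan
import Summits.KontsevichZagierPeriods.KontsevichZagierPeriods.Theorems.FermatIsogenyBetaLinearSectorSixthsStubSexticHalf
import HarnessLib

/-!
# `BetaLinearSector` (stmt-KontsevichZagierPeriods-3897), line `fermat-sector-transport` —
# stub `stub_sexticHalf_equivalent_affine` (Euler's reflection at `1/6`, step 3)

The LEVEL-6 rung (`a, b, a', b' ∈ ⅙ℤ`) of the crux `BetaLinearSector` (route FermatIsogeny) needs
Euler's reflection formula at `1/6`, `sin(π/6) · B(1/6, 5/6) = π`, INSIDE the Kontsevich–Zagier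
calculus.  Steps 1–2 (the neighbouring stubs) carry `B(1/6, 5/6)` to the rational representation
`H = [(0,1/2), 6((1-w)⁴ + w⁴)/Q₆(w)]`, `Q₆(w) = w⁶ + (1-w)⁶`.  This file is step 3:

* `stub_sexticHalf_equivalent_affine` — ONE AFFINE change of variables (rule 2)),
  `v = φ(w) = 1 - 2w` from `(0,1/2)` onto `(0,1)` (injective, `φ' = -2`, `|φ'| = 2`, inverse
  `w = (1-v)/2`), under which, with `a = w = (1-v)/2`, `b = 1-w = (1+v)/2`,
  `8(a⁴ + b⁴) = 1 + 6v² + v⁴` and `32(a⁶ + b⁶) = (1 + v²)(1 + 14v² + v⁴)`; hence the pull-back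
  `H.integrand(w) = V.integrand(1-2w) · 2` for the EVEN rational representation
  `V = [(0,1), 12(1 + 6v² + v⁴)/((1 + v²)(1 + 14v² + v⁴))]`: `H ∼ V`.

The map `φ` is a `ℚ`-polynomial, hence `ℚ`-semialgebraic (`isSemialgebraicFunOn_ratFun₁`); the
positivity `Q₆ > 0` is the landed `sexticHalf_den_pos` of step 2.
The packaging is the one-dimensional rule (2) `of_sub_of_mem_changeOfVariablesRel_dimOne`, as in
the level-3 template `GKZLevelThree.arctanArc_equivalent_half` and the level-4
`Quarters.stub_quarticHalf_equivalent_lorentz`.  All representations are PINNED by their domain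
and their integrand on it.

## References

* M. Kontsevich, D. Zagier, *Periods* (2001), §1.2 rule (2).
* G. Andrews, R. Askey, R. Roy, *Special Functions* (1999), Thm. 1.2.1 (Euler's reflection formula).
-/

noncomputable section

namespace Summit.KontsevichZagierPeriods.FermatIsogeny.BetaLinearSector.Sixths

open Set MeasureTheory
open MvPolynomial (aeval X C)
open Literature.NumberTheory.Transcendental Literature.NumberTheory.Transcendental.KZ
open Summit.KontsevichZagierPeriods.HermiteRigidity.CMTwistQuasiPeriodTransfer
  (of_sub_of_mem_changeOfVariablesRel_dimOne image_fin_one)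
open Summit.KontsevichZagierPeriods.KontsevichZagierPeriods.Theorems.GKZLevelThree
  (isSemialgebraicFunOn_ratFun₁)

/-! ## The affine substitution `v = 1 - 2w` and the two polynomial identities -/

/-- With `v = 1 - 2w`: `1 + 6v² + v⁴ = 8((1-w)⁴ + w⁴)`. [folklore] -/
theorem sexticAffine_num (w : ℝ) :
    1 + 6 * (1 - 2 * w) ^ 2 + (1 - 2 * w) ^ 4 = 8 * ((1 - w) ^ 4 + w ^ 4) := by
  ring

/-- With `v = 1 - 2w`: `(1 + v²)(1 + 14v² + v⁴) = 32(w⁶ + (1-w)⁶)`. [folklore] -/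
theorem sexticAffine_den (w : ℝ) :
    (1 + (1 - 2 * w) ^ 2) * (1 + 14 * (1 - 2 * w) ^ 2 + (1 - 2 * w) ^ 4) =
      32 * (w ^ 6 + (1 - w) ^ 6) := by
  ring

/-- The pull-back identity of step 3:
`6((1-w)⁴ + w⁴)/(w⁶ + (1-w)⁶) = 12(1 + 6v² + v⁴)/((1 + v²)(1 + 14v² + v⁴)) · |-2|`, `v = 1 - 2w`
(`Q₆ = w⁶ + (1-w)⁶ > 0` is `sexticHalf_den_pos`). [folklore] -/
theorem sexticAffine_pullback (w : ℝ) :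
    6 * ((1 - w) ^ 4 + w ^ 4) / (w ^ 6 + (1 - w) ^ 6) =
      12 * (1 + 6 * (1 - 2 * w) ^ 2 + (1 - 2 * w) ^ 4) /
        ((1 + (1 - 2 * w) ^ 2) * (1 + 14 * (1 - 2 * w) ^ 2 + (1 - 2 * w) ^ 4)) * |(-2 : ℝ)| := by
  rw [sexticAffine_num, sexticAffine_den, abs_neg, abs_two]
  have hQ := (sexticHalf_den_pos w).ne'
  field_simp
  ring

/-- The derivative of `φ(w) = 1 - 2w` is `-2`. [folklore] -/
theorem sexticAffine_hasDerivAt (w : ℝ) : HasDerivAt (fun w : ℝ => 1 - 2 * w) (-2) w := by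
  simpa using ((hasDerivAt_id' w).const_mul (2:ℝ)).const_sub (1:ℝ)

/-- `φ(w) = 1 - 2w` maps `(0, 1/2)` ONTO `(0, 1)` (inverse `w = (1-v)/2`). [folklore] -/
theorem sexticAffine_image : (fun w : ℝ => 1 - 2 * w) '' Ioo 0 (1 / 2) = Ioo 0 1 := by
  ext v
  constructor
  · rintro ⟨w, ⟨hw0, hw1⟩, rfl⟩
    exact ⟨by linarith, by linarith⟩
  · rintro ⟨hv0, hv1⟩
    exact ⟨(1 - v) / 2, ⟨by linarith, by linarith⟩, by ring⟩

/-! ## Step 3: `H ∼ V` by ONE affine change of variables -/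

/-- **Step 3 of Euler's reflection at `1/6`.**
`[(0,1/2), 6((1-w)⁴+w⁴)/(w⁶+(1-w)⁶)] ∼ [(0,1), 12(1+6v²+v⁴)/((1+v²)(1+14v²+v⁴))]` by ONE affine
change of variables `v = φ(w) = 1 - 2w` (rule 2)): a `ℚ`-polynomial (hence `ℚ`-semialgebraic),
injective, with image `(0,1)`, derivative `-2`, and the pull-back identity `sexticAffine_pullback`
(`8((1-w)⁴+w⁴) = 1+6v²+v⁴`, `32(w⁶+(1-w)⁶) = (1+v²)(1+14v²+v⁴)`).
[cite: KontsevichZagier2001, §1.2 rule (2)] -/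
theorem stub_sexticHalf_equivalent_affine : ∀ (H V : KZ.IntegralRep 1), H.domain = {x | 0 < x 0 ∧ x 0 < 1 / 2} → Set.EqOn H.integrand (fun x => 6 * ((1 - x 0) ^ 4 + (x 0) ^ 4) / ((x 0) ^ 6 + (1 - x 0) ^ 6)) H.domain → V.domain = {x | x 0 ∈ Set.Ioo (0:ℝ) 1} → Set.EqOn V.integrand (fun x => 12 * (1 + 6 * (x 0) ^ 2 + (x 0) ^ 4) / ((1 + (x 0) ^ 2) * (1 + 14 * (x 0) ^ 2 + (x 0) ^ 4))) V.domain → KZ.Equivalent H V := by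
  intro H V hHd hHi hVd hVi
  set φ : ℝ → ℝ := fun w => 1 - 2 * w with hφ
  set φ' : ℝ → ℝ := fun _ => -2 with hφ'
  have hmem : ∀ p ∈ H.domain, 0 < p 0 ∧ p 0 < 1 / 2 := fun p hp => by rw [hHd] at hp; exact hp
  refine changeOfVariablesRel_subset_relations
    (of_sub_of_mem_changeOfVariablesRel_dimOne H V φ φ' ?_ ?_ ?_ ?_ ?_)
  · -- semialgebraic: a `ℚ`-polynomial of `p 0`
    refine isSemialgebraicFunOn_ratFun₁ H.isSemialgebraic_domain (1 - C 2 * X 0) 1 φ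
      (fun x _ => by simp) (fun x _ => ?_)
    simp only [hφ, map_sub, map_mul, MvPolynomial.aeval_C, MvPolynomial.aeval_X, map_one,
      eq_ratCast, Rat.cast_ofNat, div_one]
  · -- derivative
    intro p _
    exact sexticAffine_hasDerivAt (p 0)
  · -- injective
    intro p _ q _ h
    simp only [hφ] at h
    linarith
  · -- image
    rw [hVd, hHd]
    exact (image_fin_one sexticAffine_image).symm
  · -- integrands
    intro p hp
    have hp' := hmem p hp
    have hφp : (fun _ : Fin 1 => φ (p 0)) ∈ V.domain := by
      rw [hVd]
      show φ (p 0) ∈ Ioo (0:ℝ) 1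
      simp only [hφ]
      exact ⟨by linarith [hp'.2], by linarith [hp'.1]⟩
    rw [hHi hp, hVi hφp]
    exact sexticAffine_pullback (p 0)

end Summit.KontsevichZagierPeriods.FermatIsogeny.BetaLinearSector.Sixths

end
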